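/-
Copyright (c) 2026. All rights reserved.
Released under Apache 2.0 license as described in the file LICENSE.
Authors: HodgeCM publication cell (pub/hodgecm-mathlib), Track B, seat K2E3-p11 (g4).
-/
import Literature.NumberTheory.Automorphic.GLnLeviQuotientIwasawaIntegration   -- ★ `unipotentRadicalGL`, `isInvInvariant_of_isMulRightInvariant`, local-field Haar (`map_mul_left_addHaar`)
import HarnessLib

/-!
# K2_E3 road (h413), Richardson road (R2-Borel), brick (B1) — Haar measure on the upper unitriangular group `N₃ ≤ GL₃(F)` in coordinates

Cell `pub/hodgecm-mathlib` (D-0151), Track B, seat K2E3-p11 (g4) (Richardson road owner; squad bus 2026-09-04T04:37Z).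
`--supports stmt-HodgeConjecture-24833 --as helper`; THEOREMS ONLY (no definition ∕ instance ∕ notation ∕ named fact ∕ `sorry`); never imports
`Cruxes/…/Lines`.  COUNT-NEUTRAL.

Purpose.  The regular nilpotent orbit of `𝔤𝔩₃(F)` is the Richardson orbit of the BOREL subgroup `B = T N₃`; the conjugation invariance of its unipotent
average `Λ_B(f) = ∫_K ∫_{N₃} f(k u k⁻¹)` (brick (B2)) goes through the tree's Iwasawa formula over `G ⧸ T` (★ `exists_integral_descConj_levi_eq_smul` for the
labelling `c = id : Fin 3 → Fin 3`: `U_c = N₃`, `M_c = T`), which wants an INVERSION-INVARIANT Haar measure on `N₃ = unipotentRadicalGL F id` (the tree has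
this only for two-block, abelian, radicals), and through the twisted-commutator substitution `u t u⁻¹ = ψ_t(u) t` on `N₃` at a regular diagonal `t`.  Both are
proved here in the coordinates `e(x, y, z) = [[1, x, z], [0, 1, y], [0, 0, 1]]` (`N₃` is the Heisenberg group of `F`):
* §1 (any commutative ring) `mem_borelUnipotentGL3_iff`, **`exists_coordHomeomorph`** (`e : (R × R) × R ≃ₜ N₃` with `↑(e p) = [[1,x,z],[0,1,y],[0,0,1]]`, an
  EXISTENCE; every later theorem takes `e` and `he : ∀ p, ↑(e p) = !![…]` as hypotheses), `coord_mul` (`e(x,y,z) e(x′,y′,z′) = e(x+x′, y+y′, z+z′+x y′)`),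
  `coord_one`, `coord_inv`, `mul_left_comp_coord`, `mul_right_comp_coord`;
* §2 (`F` non-archimedean local, `vol = (μ_F ⊗ μ_F) ⊗ μ_F`) `map_coordMulLeft`, `map_coordMulRight` (translations are measure-preserving skew products),
  **`isHaarMeasure_map_coord`** (`e_* vol` is a Haar measure), `isMulRightInvariant_map_coord`, **`exists_haar_eq_smul_map_coord`** (every Haar measure on `N₃` is
  `C • e_* vol`), **`isInvInvariant_haar_borelUnipotentGL3`** (`N₃` is unimodular: the hypothesis `[μN.IsInvInvariant]` of the Iwasawa formula for `c = id`);
* §3 `map_coordScale`, `map_coordShear`, **`exists_homeomorph_conj_diagonal_eq_mul`** — for `t = diag(d₀, d₁, d₂)` with pairwise distinct `dᵢ` a homeomorphism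
  `ψ : N₃ ≃ₜ N₃` with `u t u⁻¹ = ψ(u) t` and `ψ_* μN = c • μN`, `c = ‖(1 − d₀/d₁)(1 − d₁/d₂)(1 − d₀/d₂)‖_F⁻¹ ≠ 0` (a shear followed by a diagonal scaling).
[Rogawski1990, §4.13, proof of Lemma 4.13.1 p. 70] [HarishChandra1970, §I.2 Lemma 3 (`n ↦ n γ n⁻¹ γ⁻¹`)] [BernsteinZelevinsky1976, §1.18–§1.19].

References: [Rogawski1990] J. D. Rogawski, Ann. of Math. Stud. 123 (1990), §4.13 p. 70 · [HarishChandra1970] Harish-Chandra (notes by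
G. van Dijk), LNM 162 (1970), §I.2 · [BernsteinZelevinsky1976] Russian Math. Surveys 31:3 (1976), §1.18–§1.19 · [Tate1950] J. Tate, thesis (1950), §2.2.
-/

set_option autoImplicit false
set_option linter.dupNamespace false   -- `Summit.HodgeConjecture.HodgeConjecture.…` (D-0017 nested layout; lakefile exemption for Summits)

noncomputable section

open MeasureTheory Measure Filter Topology TopologicalSpace
open scoped MatrixGroups NNReal ENNReal
open Literature.NumberTheory.Automorphic
open Literature.NumberTheory.GaloisRepresentations Literature.NumberTheory.GaloisRepresentations.IsNonarchimedeanLocalField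

namespace Summit.HodgeConjecture.HodgeConjecture.Cruxes.H413.K2E3GL3BorelUnipotentHaar

/-! ## §1  Coordinates on `N₃ = unipotentRadicalGL R id ≤ GL₃(R)` -/

section Algebra

variable {R : Type*} [CommRing R]

/-- **An element of the unipotent radical of the Borel subgroup of `GL₃` is an upper unitriangular matrix**: `g ∈ U_id` iff
`↑g = [[1, g₀₁, g₀₂], [0, 1, g₁₂], [0, 0, 1]]`. [cite: BernsteinZelevinsky1976, §1.18] -/
theorem mem_borelUnipotentGL3_iff (g : GL (Fin 3) R) :
    g ∈ unipotentRadicalGL R (id : Fin 3 → Fin 3) ↔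
      (g : Matrix (Fin 3) (Fin 3) R) =
        !![1, (g : Matrix (Fin 3) (Fin 3) R) 0 1, (g : Matrix (Fin 3) (Fin 3) R) 0 2;
           0, 1, (g : Matrix (Fin 3) (Fin 3) R) 1 2;
           0, 0, 1] := by
  rw [mem_unipotentRadicalGL_iff]
  constructor
  · rintro ⟨hT, h1⟩
    have hd : ∀ a : Fin 3, (g : Matrix (Fin 3) (Fin 3) R) a a = 1 := fun a => by
      have h := congrFun (congrFun (h1 a) ⟨a, rfl⟩) ⟨a, rfl⟩
      rw [Matrix.one_apply_eq] at h
      exact h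
    have hl : ∀ i j : Fin 3, j < i → (g : Matrix (Fin 3) (Fin 3) R) i j = 0 := fun i j hij => hT hij
    ext i j
    fin_cases i <;> fin_cases j <;> first
      | rfl
      | exact hd _
      | exact hl _ _ (by decide)
  · intro hg
    refine ⟨?_, fun a => ?_⟩
    · intro i j hij
      rw [hg]
      fin_cases i <;> fin_cases j <;> first | rfl | exact absurd hij (by decide)
    · ext ⟨i, hi⟩ ⟨j, hj⟩
      simp only [id_eq] at hi hj
      obtain rfl : i = j := hi.trans hj.symm
      rw [Matrix.toSquareBlock_def, Matrix.of_apply, Matrix.one_apply_eq, hg]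
      fin_cases i <;> rfl

variable [TopologicalSpace R] [IsTopologicalRing R]

/-- **Coordinates on `N₃`**: a homeomorphism `e : (R × R) × R ≃ₜ U_id(GL₃(R))` with `↑(e ((x, y), z)) = [[1, x, z], [0, 1, y], [0, 0, 1]]`
(inverse `u ↦ ((u₀₁, u₁₂), u₀₂)`). [cite: BernsteinZelevinsky1976, §1.18] -/
theorem exists_coordHomeomorph :
    ∃ e : (R × R) × R ≃ₜ ↥(unipotentRadicalGL R (id : Fin 3 → Fin 3)),
      ∀ p : (R × R) × R, (((e p : ↥(unipotentRadicalGL R (id : Fin 3 → Fin 3))) : GL (Fin 3) R) : Matrix (Fin 3) (Fin 3) R) =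
        !![1, p.1.1, p.2; 0, 1, p.1.2; 0, 0, 1] := by
  -- the unit `[[1,x,z],[0,1,y],[0,0,1]]` with inverse `[[1,-x,xy-z],[0,1,-y],[0,0,1]]`
  have hmul : ∀ p : (R × R) × R,
      (!![1, p.1.1, p.2; 0, 1, p.1.2; 0, 0, 1] : Matrix (Fin 3) (Fin 3) R) * !![1, -p.1.1, p.1.1 * p.1.2 - p.2; 0, 1, -p.1.2; 0, 0, 1] = 1 := fun p => by
    ext i j
    fin_cases i <;> fin_cases j <;> simp [Matrix.mul_apply, Fin.sum_univ_three]
    ring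
  have hmul' : ∀ p : (R × R) × R,
      (!![1, -p.1.1, p.1.1 * p.1.2 - p.2; 0, 1, -p.1.2; 0, 0, 1] : Matrix (Fin 3) (Fin 3) R) * !![1, p.1.1, p.2; 0, 1, p.1.2; 0, 0, 1] = 1 := fun p => by
    ext i j
    fin_cases i <;> fin_cases j <;> simp [Matrix.mul_apply, Fin.sum_univ_three]
    ring
  have hmem : ∀ p : (R × R) × R,
      (⟨!![1, p.1.1, p.2; 0, 1, p.1.2; 0, 0, 1], !![1, -p.1.1, p.1.1 * p.1.2 - p.2; 0, 1, -p.1.2; 0, 0, 1], hmul p, hmul' p⟩ : GL (Fin 3) R) ∈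
        unipotentRadicalGL R (id : Fin 3 → Fin 3) := fun p => by
    rw [mem_borelUnipotentGL3_iff]
    simp
  refine ⟨{ toFun := fun p => ⟨_, hmem p⟩,
             invFun := fun u => (((((u : GL (Fin 3) R)) : Matrix (Fin 3) (Fin 3) R) 0 1, (((u : GL (Fin 3) R)) : Matrix (Fin 3) (Fin 3) R) 1 2), (((u : GL (Fin 3) R)) : Matrix (Fin 3) (Fin 3) R) 0 2),
             left_inv := fun p => by simp,
             right_inv := fun u => Subtype.ext (Units.ext ((mem_borelUnipotentGL3_iff _).1 u.2).symm),
             continuous_toFun := ?_,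
             continuous_invFun := ?_ }, fun p => rfl⟩
  · refine Continuous.subtype_mk (Units.continuous_iff.2 ⟨?_, ?_⟩) _
    · refine continuous_matrix fun i j => ?_
      fin_cases i <;> fin_cases j <;> simp <;> fun_prop
    · refine continuous_matrix fun i j => ?_
      fin_cases i <;> fin_cases j <;> simp <;> fun_prop
  · have hc : Continuous fun u : ↥(unipotentRadicalGL R (id : Fin 3 → Fin 3)) => (((u : GL (Fin 3) R)) : Matrix (Fin 3) (Fin 3) R) :=
      Units.continuous_val.comp continuous_subtype_val
    exact ((hc.matrix_elem 0 1).prodMk (hc.matrix_elem 1 2)).prodMk (hc.matrix_elem 0 2)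

variable (e : (R × R) × R ≃ₜ ↥(unipotentRadicalGL R (id : Fin 3 → Fin 3)))
  (he : ∀ p : (R × R) × R, (((e p : ↥(unipotentRadicalGL R (id : Fin 3 → Fin 3))) : GL (Fin 3) R) : Matrix (Fin 3) (Fin 3) R) =
    !![1, p.1.1, p.2; 0, 1, p.1.2; 0, 0, 1])
include he

omit [IsTopologicalRing R] in
/-- **The group law in coordinates**: `e(x,y,z) · e(x′,y′,z′) = e(x + x′, y + y′, z + z′ + x y′)` (the Heisenberg law). [cite: BernsteinZelevinsky1976, §1.18] -/
theorem coord_mul (p q : (R × R) × R) :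
    e p * e q = e ((p.1.1 + q.1.1, p.1.2 + q.1.2), p.2 + q.2 + p.1.1 * q.1.2) := by
  apply Subtype.ext
  apply Units.ext
  rw [Subgroup.coe_mul, Units.val_mul, he, he, he]
  ext i j
  fin_cases i <;> fin_cases j <;> simp [Matrix.mul_apply, Fin.sum_univ_three] <;> ring

omit [IsTopologicalRing R] in
/-- `e(0, 0, 0) = 1`. [folklore] -/
theorem coord_one : e ((0, 0), 0) = 1 := by
  apply Subtype.ext
  apply Units.ext
  rw [he, Subgroup.coe_one, Units.val_one]
  ext i j
  fin_cases i <;> fin_cases j <;> simp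

omit [IsTopologicalRing R] in
/-- **Inversion in coordinates**: `e(x,y,z)⁻¹ = e(−x, −y, x y − z)`. [cite: BernsteinZelevinsky1976, §1.18] -/
theorem coord_inv (p : (R × R) × R) : (e p)⁻¹ = e ((-p.1.1, -p.1.2), p.1.1 * p.1.2 - p.2) := by
  rw [inv_eq_iff_mul_eq_one, coord_mul e he, ← coord_one e he]
  congr 1
  ext <;> simp

omit [IsTopologicalRing R] in
/-- Left translation by `g = e(a,b,c)` in coordinates: `g · e(x,y,z) = e(a + x, b + y, c + z + a y)`. [cite: BernsteinZelevinsky1976, §1.18] -/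
theorem mul_left_comp_coord (g : ↥(unipotentRadicalGL R (id : Fin 3 → Fin 3))) :
    (fun u => g * u) ∘ e = e ∘ fun p : (R × R) × R =>
      (((e.symm g).1.1 + p.1.1, (e.symm g).1.2 + p.1.2), (e.symm g).2 + p.2 + (e.symm g).1.1 * p.1.2) := by
  funext p
  simp only [Function.comp_apply]
  conv_lhs => rw [← e.apply_symm_apply g]
  rw [coord_mul e he]

omit [IsTopologicalRing R] in
/-- Right translation by `g = e(a,b,c)` in coordinates: `e(x,y,z) · g = e(x + a, y + b, z + c + x b)`. [cite: BernsteinZelevinsky1976, §1.18] -/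
theorem mul_right_comp_coord (g : ↥(unipotentRadicalGL R (id : Fin 3 → Fin 3))) :
    (fun u => u * g) ∘ e = e ∘ fun p : (R × R) × R =>
      ((p.1.1 + (e.symm g).1.1, p.1.2 + (e.symm g).1.2), p.2 + (e.symm g).2 + p.1.1 * (e.symm g).1.2) := by
  funext p
  simp only [Function.comp_apply]
  conv_lhs => rw [← e.apply_symm_apply g]
  rw [coord_mul e he]

end Algebra

/-! ## §2  The Haar measure of `N₃` in coordinates; `N₃` is unimodular -/

section Haar

variable {F : Type*} [Field F] [ValuativeRel F] [TopologicalSpace F] [IsNonarchimedeanLocalField F]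
  [MeasurableSpace F] [BorelSpace F]
  [MeasurableSpace ↥(unipotentRadicalGL F (id : Fin 3 → Fin 3))] [BorelSpace ↥(unipotentRadicalGL F (id : Fin 3 → Fin 3))]
  (e : (F × F) × F ≃ₜ ↥(unipotentRadicalGL F (id : Fin 3 → Fin 3)))
  (he : ∀ p : (F × F) × F, (((e p : ↥(unipotentRadicalGL F (id : Fin 3 → Fin 3))) : GL (Fin 3) F) : Matrix (Fin 3) (Fin 3) F) =
    !![1, p.1.1, p.2; 0, 1, p.1.2; 0, 0, 1])
  (μF : Measure F) [μF.IsAddHaarMeasure]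

omit [ValuativeRel F] [IsNonarchimedeanLocalField F] [MeasurableSpace ↥(unipotentRadicalGL F (id : Fin 3 → Fin 3))] [BorelSpace ↥(unipotentRadicalGL F (id : Fin 3 → Fin 3))] in
/-- **Left translations preserve `vol = (μ_F ⊗ μ_F) ⊗ μ_F` in coordinates**: `(x,y,z) ↦ (a + x, b + y, c + z + a y)` is a skew product of a translation of
`F × F` with translations of `F`. [cite: BernsteinZelevinsky1976, §1.19] -/
theorem map_coordMulLeft [IsTopologicalRing F] [SecondCountableTopology F] [SFinite μF] (a b c : F) :
    ((μF.prod μF).prod μF).map (fun p : (F × F) × F => ((a + p.1.1, b + p.1.2), c + p.2 + a * p.1.2)) = (μF.prod μF).prod μF := by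
  have h1 : MeasurePreserving (fun q : F × F => (a + q.1, b + q.2)) (μF.prod μF) (μF.prod μF) :=
    measurePreserving_add_left (μF.prod μF) (a, b)
  have h2 : MeasurePreserving (fun p : (F × F) × F => ((a + p.1.1, b + p.1.2), c + p.2 + a * p.1.2))
      ((μF.prod μF).prod μF) ((μF.prod μF).prod μF) := by
    refine h1.skew_product (g := fun q z => c + z + a * q.2) (by fun_prop) (Eventually.of_forall fun q => ?_)
    have hfun : (fun z : F => c + z + a * q.2) = fun z => (c + a * q.2) + z := funext fun z => by ring
    rw [hfun]
    exact map_add_left_eq_self μF _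
  exact h2.map_eq

omit [ValuativeRel F] [IsNonarchimedeanLocalField F] [MeasurableSpace ↥(unipotentRadicalGL F (id : Fin 3 → Fin 3))] [BorelSpace ↥(unipotentRadicalGL F (id : Fin 3 → Fin 3))] in
/-- **Right translations preserve `vol` in coordinates**: `(x,y,z) ↦ (x + a, y + b, z + c + x b)`. [cite: BernsteinZelevinsky1976, §1.19] -/
theorem map_coordMulRight [IsTopologicalRing F] [SecondCountableTopology F] [SFinite μF] (a b c : F) :
    ((μF.prod μF).prod μF).map (fun p : (F × F) × F => ((p.1.1 + a, p.1.2 + b), p.2 + c + p.1.1 * b)) = (μF.prod μF).prod μF := by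
  have h1 : MeasurePreserving (fun q : F × F => (q.1 + a, q.2 + b)) (μF.prod μF) (μF.prod μF) :=
    measurePreserving_add_right (μF.prod μF) (a, b)
  have h2 : MeasurePreserving (fun p : (F × F) × F => ((p.1.1 + a, p.1.2 + b), p.2 + c + p.1.1 * b))
      ((μF.prod μF).prod μF) ((μF.prod μF).prod μF) := by
    refine h1.skew_product (g := fun q z => z + c + q.1 * b) (by fun_prop) (Eventually.of_forall fun q => ?_)
    have hfun : (fun z : F => z + c + q.1 * b) = fun z => z + (c + q.1 * b) := funext fun z => by ring
    rw [hfun]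
    exact map_add_right_eq_self μF _
  exact h2.map_eq

include he

/-- **`e_* vol` is a Haar measure on `N₃`**: left invariant (`map_coordMulLeft`), finite on compacts and positive on opens (`e` is a homeomorphism).
[cite: BernsteinZelevinsky1976, §1.19] -/
theorem isHaarMeasure_map_coord : IsHaarMeasure (((μF.prod μF).prod μF).map e) := by
  haveI : T2Space F := (isLocalField F).toT2Space
  haveI : LocallyCompactSpace F := (isLocalField F).toLocallyCompactSpace
  haveI : SecondCountableTopology F := secondCountableTopology_localField F
  haveI : IsTopologicalRing F := inferInstance
  have hme : Measurable e := e.continuous.measurable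
  exact
    { map_mul_left_eq_self := fun g => by
        have hL : Measurable fun p : (F × F) × F =>
            (((e.symm g).1.1 + p.1.1, (e.symm g).1.2 + p.1.2), (e.symm g).2 + p.2 + (e.symm g).1.1 * p.1.2) := by fun_prop
        rw [map_map (measurable_const_mul g) hme, mul_left_comp_coord e he g, ← map_map hme hL, map_coordMulLeft]
      lt_top_of_isCompact := (IsFiniteMeasureOnCompacts.map _ e).lt_top_of_isCompact
      open_pos := (e.continuous.isOpenPosMeasure_map e.surjective).open_pos }

/-- `e_* vol` is also RIGHT invariant (`map_coordMulRight`). [cite: BernsteinZelevinsky1976, §1.19] -/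
theorem isMulRightInvariant_map_coord : (((μF.prod μF).prod μF).map e).IsMulRightInvariant := by
  haveI : T2Space F := (isLocalField F).toT2Space
  haveI : SecondCountableTopology F := secondCountableTopology_localField F
  haveI : IsTopologicalRing F := inferInstance
  have hme : Measurable e := e.continuous.measurable
  refine ⟨fun g => ?_⟩
  have hR : Measurable fun p : (F × F) × F =>
      ((p.1.1 + (e.symm g).1.1, p.1.2 + (e.symm g).1.2), p.2 + (e.symm g).2 + p.1.1 * (e.symm g).1.2) := by fun_prop
  rw [map_map (measurable_mul_const g) hme, mul_right_comp_coord e he g, ← map_map hme hR, map_coordMulRight]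

/-- **Every Haar measure on `N₃` is `C • e_* vol`, `C ≠ 0`** (uniqueness of Haar measure on the second countable locally compact group `N₃`).
[cite: BernsteinZelevinsky1976, §1.19] -/
theorem exists_haar_eq_smul_map_coord (μN : Measure ↥(unipotentRadicalGL F (id : Fin 3 → Fin 3))) [IsHaarMeasure μN] :
    ∃ C : ℝ≥0, C ≠ 0 ∧ μN = C • ((μF.prod μF).prod μF).map e := by
  haveI : T2Space F := (isLocalField F).toT2Space
  haveI : LocallyCompactSpace F := (isLocalField F).toLocallyCompactSpace
  haveI : SecondCountableTopology F := secondCountableTopology_localField F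
  haveI : SecondCountableTopology ↥(unipotentRadicalGL F (id : Fin 3 → Fin 3)) := e.symm.secondCountableTopology
  haveI : LocallyCompactSpace ↥(unipotentRadicalGL F (id : Fin 3 → Fin 3)) := e.symm.isClosedEmbedding.locallyCompactSpace
  haveI := isHaarMeasure_map_coord e he μF
  exact ⟨haarScalarFactor μN (((μF.prod μF).prod μF).map e), (haarScalarFactor_pos_of_isHaarMeasure _ _).ne',
    isMulLeftInvariant_eq_smul μN _⟩

omit he e μF in
/-- **`N₃` is unimodular: every Haar measure on the upper unitriangular group of `GL₃(F)` is inversion invariant** — the hypothesis `[μN.IsInvInvariant]` of ★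
`exists_integral_descConj_levi_eq_smul` ∕ `exists_quotientMeasure_levi_eq_smul_map` for the Borel labelling `c = id : Fin 3 → Fin 3` (for two-block labellings this is ★
`isInvInvariant_haar_unipotentRadicalGL`).  Proof: `μN = C • e_* vol` is right invariant, and a left-and-right invariant Haar measure is inversion invariant.
[cite: BernsteinZelevinsky1976, §1.19] [cite: Rogawski1990, §4.13 p. 70] -/
theorem isInvInvariant_haar_borelUnipotentGL3 (μN : Measure ↥(unipotentRadicalGL F (id : Fin 3 → Fin 3))) [IsHaarMeasure μN] :
    μN.IsInvInvariant := by
  haveI : T2Space F := (isLocalField F).toT2Space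
  haveI : LocallyCompactSpace F := (isLocalField F).toLocallyCompactSpace
  haveI : SecondCountableTopology F := secondCountableTopology_localField F
  haveI : IsTopologicalRing F := inferInstance
  obtain ⟨e, he⟩ := exists_coordHomeomorph (R := F)
  haveI : SecondCountableTopology ↥(unipotentRadicalGL F (id : Fin 3 → Fin 3)) := e.symm.secondCountableTopology
  haveI : LocallyCompactSpace ↥(unipotentRadicalGL F (id : Fin 3 → Fin 3)) := e.symm.isClosedEmbedding.locallyCompactSpace
  obtain ⟨C, -, hμ⟩ := exists_haar_eq_smul_map_coord e he Measure.addHaar μN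
  haveI := isMulRightInvariant_map_coord e he (Measure.addHaar : Measure F)
  haveI : μN.IsMulRightInvariant := by rw [hμ]; infer_instance
  exact isInvInvariant_of_isMulRightInvariant μN

end Haar

/-! ## §3  The twisted commutator `u ↦ u t u⁻¹ t⁻¹` at a regular diagonal `t` rescales the Haar measure of `N₃` -/

section Twisted

variable {F : Type*} [Field F] [ValuativeRel F] [TopologicalSpace F] [IsNonarchimedeanLocalField F]
  [MeasurableSpace F] [BorelSpace F]
  [MeasurableSpace ↥(unipotentRadicalGL F (id : Fin 3 → Fin 3))] [BorelSpace ↥(unipotentRadicalGL F (id : Fin 3 → Fin 3))]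

omit [MeasurableSpace ↥(unipotentRadicalGL F (id : Fin 3 → Fin 3))] [BorelSpace ↥(unipotentRadicalGL F (id : Fin 3 → Fin 3))] in
/-- **The diagonal scaling `(x,y,z) ↦ (α x, β y, γ z)` multiplies `vol` by `‖α‖⁻¹‖β‖⁻¹‖γ‖⁻¹`** (★ `map_mul_left_addHaar` in each coordinate, `map_prod_map`).
[cite: BernsteinZelevinsky1976, §1.19] [cite: Tate1950, §2.2, Lemma 2.2.5] -/
theorem map_coordScale (μF : Measure F) [μF.IsAddHaarMeasure] {α β γ : F} (hα : α ≠ 0) (hβ : β ≠ 0) (hγ : γ ≠ 0) :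
    ((μF.prod μF).prod μF).map (fun p : (F × F) × F => ((α * p.1.1, β * p.1.2), γ * p.2)) =
      (((normAbs F α⁻¹ * normAbs F β⁻¹ * normAbs F γ⁻¹ : ℝ≥0)) : ℝ≥0∞) • (μF.prod μF).prod μF := by
  haveI : T2Space F := (isLocalField F).toT2Space
  haveI : LocallyCompactSpace F := (isLocalField F).toLocallyCompactSpace
  haveI : SecondCountableTopology F := secondCountableTopology_localField F
  haveI : IsTopologicalRing F := inferInstance
  have h : (fun p : (F × F) × F => ((α * p.1.1, β * p.1.2), γ * p.2)) =
      Prod.map (Prod.map (fun x => α * x) (fun x => β * x)) (fun x => γ * x) := rfl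
  rw [h, ← Measure.map_prod_map _ _ ((measurable_const_mul α).prodMap (measurable_const_mul β)) (measurable_const_mul γ),
    ← Measure.map_prod_map _ _ (measurable_const_mul α) (measurable_const_mul β),
    map_mul_left_addHaar μF hα, map_mul_left_addHaar μF hβ, map_mul_left_addHaar μF hγ]
  simp only [Measure.prod_smul_left, Measure.prod_smul_right, smul_smul, ENNReal.coe_mul]
  congr 1
  ring

omit [ValuativeRel F] [IsNonarchimedeanLocalField F] [MeasurableSpace ↥(unipotentRadicalGL F (id : Fin 3 → Fin 3))] [BorelSpace ↥(unipotentRadicalGL F (id : Fin 3 → Fin 3))] in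
/-- **The shear `(x,y,z) ↦ (x, y, z + σ x y)` preserves `vol`** (a skew product of the identity of `F × F` with translations of `F`).
[cite: BernsteinZelevinsky1976, §1.19] -/
theorem map_coordShear [IsTopologicalRing F] [SecondCountableTopology F] (μF : Measure F) [μF.IsAddHaarMeasure] [SFinite μF] (σ : F) :
    ((μF.prod μF).prod μF).map (fun p : (F × F) × F => (p.1, p.2 + σ * p.1.1 * p.1.2)) = (μF.prod μF).prod μF := by
  have h : MeasurePreserving (fun p : (F × F) × F => (id p.1, p.2 + σ * p.1.1 * p.1.2)) ((μF.prod μF).prod μF) ((μF.prod μF).prod μF) := by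
    refine (MeasurePreserving.id (μF.prod μF)).skew_product (g := fun q z => z + σ * q.1 * q.2) (by fun_prop)
      (Eventually.of_forall fun q => ?_)
    exact map_add_right_eq_self μF _
  exact h.map_eq

/-- **Twisted commutator at a regular diagonal element.**  Let `t = diag(d₀, d₁, d₂) ∈ GL₃(F)` with `d₀, d₁, d₂` pairwise distinct and `μN` a Haar measure on
`N₃`.  There is a homeomorphism `ψ : N₃ ≃ₜ N₃` (namely `ψ(u) = u t u⁻¹ t⁻¹`; in coordinates
`(x,y,z) ↦ ((1 − d₀/d₁) x, (1 − d₁/d₂) y, (1 − d₀/d₂)(z + σ x y))`, `σ = (d₀ − d₁)/(d₂ − d₀)`) with **`u t u⁻¹ = ψ(u) t`** for all `u ∈ N₃` and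
**`ψ_* μN = c • μN`, `c = ‖(1 − d₀/d₁)(1 − d₁/d₂)(1 − d₀/d₂)‖_F⁻¹ ≠ 0`** — so that `∫_{N₃} φ(u t u⁻¹) du = c ∫_{N₃} φ(v t) dv`.  This is the substitution
`n ↦ n γ n⁻¹ γ⁻¹` of the unipotent radical at a `(G, T)`-regular `γ`, here for the Borel subgroup of `GL₃`.
[cite: Rogawski1990, §4.13, proof of Lemma 4.13.1, p. 70] [cite: HarishChandra1970, §I.2, Lemma 3] -/
theorem exists_homeomorph_conj_diagonal_eq_mul (t : GL (Fin 3) F) (d : Fin 3 → F)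
    (ht : (t : Matrix (Fin 3) (Fin 3) F) = Matrix.diagonal d) (h01 : d 0 ≠ d 1) (h12 : d 1 ≠ d 2) (h02 : d 0 ≠ d 2)
    (μN : Measure ↥(unipotentRadicalGL F (id : Fin 3 → Fin 3))) [IsHaarMeasure μN] :
    ∃ ψ : ↥(unipotentRadicalGL F (id : Fin 3 → Fin 3)) ≃ₜ ↥(unipotentRadicalGL F (id : Fin 3 → Fin 3)),
      (∀ u : ↥(unipotentRadicalGL F (id : Fin 3 → Fin 3)),
          (u : GL (Fin 3) F) * t * (u : GL (Fin 3) F)⁻¹ = ((ψ u : ↥(unipotentRadicalGL F (id : Fin 3 → Fin 3))) : GL (Fin 3) F) * t) ∧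
      ∃ c : ℝ≥0, c ≠ 0 ∧ μN.map ψ = c • μN := by
  haveI : T2Space F := (isLocalField F).toT2Space
  haveI : LocallyCompactSpace F := (isLocalField F).toLocallyCompactSpace
  haveI : SecondCountableTopology F := secondCountableTopology_localField F
  haveI : IsTopologicalRing F := inferInstance
  -- the entries of `t` are non-zero
  have hdet : (Matrix.diagonal d).det ≠ 0 := by rw [← ht, ← Matrix.GeneralLinearGroup.val_det_apply]; exact (Matrix.GeneralLinearGroup.det t).ne_zero
  rw [Matrix.det_diagonal] at hdet
  have hd : ∀ i, d i ≠ 0 := fun i => (Finset.prod_ne_zero_iff.1 hdet) i (Finset.mem_univ i)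
  obtain ⟨hd0, hd1, hd2⟩ : d 0 ≠ 0 ∧ d 1 ≠ 0 ∧ d 2 ≠ 0 := ⟨hd 0, hd 1, hd 2⟩
  have h20 : d 2 - d 0 ≠ 0 := sub_ne_zero.2 (Ne.symm h02)
  -- the three eigenvalues of `Ad(t⁻¹) - 1` on `𝔫`
  have hα : (1 - d 0 / d 1 : F) ≠ 0 := by rw [sub_ne_zero, ne_comm, Ne, div_eq_one_iff_eq hd1]; exact h01
  have hβ : (1 - d 1 / d 2 : F) ≠ 0 := by rw [sub_ne_zero, ne_comm, Ne, div_eq_one_iff_eq hd2]; exact h12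
  have hγ : (1 - d 0 / d 2 : F) ≠ 0 := by rw [sub_ne_zero, ne_comm, Ne, div_eq_one_iff_eq hd2]; exact h02
  obtain ⟨e, he⟩ := exists_coordHomeomorph (R := F)
  -- the shear `S` and the scaling `D` in coordinates
  let S : (F × F) × F ≃ₜ (F × F) × F :=
    { toFun := fun p => (p.1, p.2 + (d 0 - d 1) / (d 2 - d 0) * p.1.1 * p.1.2),
      invFun := fun p => (p.1, p.2 - (d 0 - d 1) / (d 2 - d 0) * p.1.1 * p.1.2),
      left_inv := fun p => by ext <;> simp,
      right_inv := fun p => by ext <;> simp,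
      continuous_toFun := by fun_prop,
      continuous_invFun := by fun_prop }
  let D : (F × F) × F ≃ₜ (F × F) × F :=
    (Homeomorph.prodCongr (Homeomorph.mulLeft₀ _ hα) (Homeomorph.mulLeft₀ _ hβ)).prodCongr (Homeomorph.mulLeft₀ _ hγ)
  have hSD : ∀ p : (F × F) × F, D (S p) = (((1 - d 0 / d 1) * p.1.1, (1 - d 1 / d 2) * p.1.2),
      (1 - d 0 / d 2) * (p.2 + (d 0 - d 1) / (d 2 - d 0) * p.1.1 * p.1.2)) := fun p => rfl
  refine ⟨e.symm.trans ((S.trans D).trans e), fun u => ?_, ?_⟩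
  · -- the matrix identity `u t u⁻¹ = ψ(u) t`
    obtain ⟨p, rfl⟩ := e.surjective u
    simp only [Homeomorph.trans_apply, Homeomorph.symm_apply_apply]
    rw [mul_inv_eq_iff_eq_mul]
    apply Units.ext
    have hdiag : (Matrix.diagonal d : Matrix (Fin 3) (Fin 3) F) = !![d 0, 0, 0; 0, d 1, 0; 0, 0, d 2] := by
      ext i j
      fin_cases i <;> fin_cases j <;> simp
    simp only [Units.val_mul, he, ht, hSD, hdiag]
    ext i j
    fin_cases i <;> fin_cases j <;> simp [Matrix.mul_apply, Fin.sum_univ_three] <;> field_simp <;> ring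
  · -- the measure identity `ψ_* μN = c • μN`
    obtain ⟨C, -, hμ⟩ := exists_haar_eq_smul_map_coord e he Measure.addHaar μN
    have hme : Measurable e := e.continuous.measurable
    have hS : ((Measure.addHaar.prod Measure.addHaar).prod (Measure.addHaar : Measure F)).map S =
        (Measure.addHaar.prod Measure.addHaar).prod Measure.addHaar :=
      map_coordShear (Measure.addHaar : Measure F) _
    have hD : ((Measure.addHaar.prod Measure.addHaar).prod (Measure.addHaar : Measure F)).map D =
        (((normAbs F (1 - d 0 / d 1)⁻¹ * normAbs F (1 - d 1 / d 2)⁻¹ * normAbs F (1 - d 0 / d 2)⁻¹ : ℝ≥0)) : ℝ≥0∞) •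
          (Measure.addHaar.prod Measure.addHaar).prod Measure.addHaar :=
      map_coordScale (Measure.addHaar : Measure F) hα hβ hγ
    refine ⟨normAbs F (1 - d 0 / d 1)⁻¹ * normAbs F (1 - d 1 / d 2)⁻¹ * normAbs F (1 - d 0 / d 2)⁻¹,
      mul_ne_zero (mul_ne_zero ((map_ne_zero _).2 (inv_ne_zero hα)) ((map_ne_zero _).2 (inv_ne_zero hβ)))
        ((map_ne_zero _).2 (inv_ne_zero hγ)), ?_⟩
    have hcomp : ⇑(e.symm.trans ((S.trans D).trans e)) ∘ e = e ∘ (D ∘ S) := by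
      funext p; simp
    rw [hμ, Measure.map_smul, Measure.map_map (Homeomorph.continuous _).measurable hme, hcomp,
      ← Measure.map_map hme (D.continuous.measurable.comp S.continuous.measurable),
      ← Measure.map_map D.continuous.measurable S.continuous.measurable, hS, hD, Measure.map_smul]
    simp only [ENNReal.smul_def, smul_smul, mul_comm]

end Twisted

end Summit.HodgeConjecture.HodgeConjecture.Cruxes.H413.K2E3GL3BorelUnipotentHaar

end
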